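import Summits.NavierStokesRegularity.NavierStokesRegularity.Theorems.AxisTwistDoorAveragedConeLiouvilleNUSublevelEnergySplit
import Summits.NavierStokesRegularity.NavierStokesRegularity.Theorems.AxisymmetricExtremalityAxisymmetricKatoGlobalStubSeregin2020TypeIILemma22SublevelEnergyShape
import HarnessLib

/-!
# Nazarov–Uraltseva 2011, Cor. 3.2 (N4 of cell pub/ns-inputs), piece P2b — the SHRINKING atom
# `nu_shrinking : Sig.nu_shrinking` (N–U 2012 Lemma 3.3, AXIS-FREE twin of `…Lemma22ShrinkingAtom`)

Port of ser-b g0's A1 file `…StubSeregin2020TypeIILemma22ShrinkingAtom.lean` (`lemma22_shrinking`,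
the registered shrinking atom of the A1 De Giorgi skeleton) to the axis-free standing hypotheses
`NUStanding Φ U k R N` of `…AxisTwistDoorAveragedConeLiouvilleNUDefs` (A1's `Standing` with the axis
set `S` and the axis integral of the energy class deleted).  Two steps, as in A1:

* `nu_lintegral_fderiv_sq_sublevel_le_shape'` — (3.12) with N–U's shape constants from the axis-free
  class: `∫∫_{Q ∩ {Φ<l}} |∇Φ|² ≤ C(λ, θmax, N) l² ρ³` on `Q = ]t₀-θρ², t₀[ × B(ρ)`, `R/4 ≤ ρ`,
  `λρ ≤ 2R` (sibling `…NUSublevelEnergySplit` + the landed real bookkeeping `drift_real_bound`,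
  `shape_real_algebra` of `…Lemma22SublevelEnergyShape`, the latter used with axis constant `0`);
* `nu_shrinking` — N–U 2012 Lemma 3.3 in the axis-free class: THE TEXT `Sig.nu_shrinking` of the N4
  skeleton `kits/N4-skeleton.lean` (sha16 5372b51f971b2f9d), from the measure-theoretic core
  `shrinkingLevels_measure_le` (`…Lemma22ShrinkingLevels`) and the slice-gradient measurability
  `aestronglyMeasurable_fderiv_slice_restrict_prod` (`…Lemma22GradientMeasurability`) BY NAME.

Width seat ns-in-wu-341 g2 (plan g6 ruling 11:57:22Z: P2b `stub_shrinking`).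
[cite: NazarovUraltseva2011HarnackDivFree, §3 Lemma 3.3; NazarovUraltseva2012, Lemma 3.3, (3.12), Remarks 5, 9]

WHAT THIS IS NOT: not a statement about Navier–Stokes regularity; a helper toward the discharge of
the NAMED fact `NazarovUraltseva2011_positivity_propagation` (INPUT N4); nothing is closed here.
-/

-- the problem directory repeats the summit name (D-0017); core's `dupNamespace` linter fires
set_option linter.dupNamespace false

noncomputable section

open MeasureTheory Set Function Filter Topology Metric Module
open scoped NNReal ENNReal

namespace Summit.NavierStokesRegularity.NavierStokesRegularity.Theorems.AveragedConeLiouville.NU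

open Literature.Analysis.FluidPDE Literature.Analysis.FluidPDE.LeiZhang2011
open Summit.NavierStokesRegularity.NavierStokesRegularity.Theorems.AxisymmetricKatoGlobal.EulerScaling
open Summit.NavierStokesRegularity.NavierStokesRegularity.Theorems.AveragedConeLiouville.NUPositivity

/-- **Nazarov–Uraltseva 2012, (3.12) with the shape parameters of Lemma 3.3, AXIS-FREE class.**
For `1 < λ ≤ 2`, `0 < θmax` and a drift constant `N` there is `C ≥ 0` such that: for every `Φ ≥ 0`
jointly measurable, every drift `U` a.e.-strongly measurable on the slab `]-R², 0[ × B(2R)` with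
`∫_{-R²}^0 (∫_{B(2R)} |U|³)^{4/3} ≤ N R²`, the axis-free energy class `NUEnergyClass Φ U k R`, and
every cylinder `Q = ]t₀ - θρ², t₀[ × B(ρ)` with `R/4 ≤ ρ`, `λρ ≤ 2R`, `0 < θ ≤ θmax`, `t₀ ≤ 0`,
`-R² < t₀ - θρ²`, and every level `0 < l`, `2l ≤ k`: `∫∫_{Q ∩ {Φ < l}} ‖∇Φ‖² ≤ C l² ρ³`.
[cite: NazarovUraltseva2012, (3.12), proof of Lemma 3.3, Remarks 5, 9] -/
theorem nu_lintegral_fderiv_sq_sublevel_le_shape' :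
    ∀ (lam θmax : ℝ) (N : ℝ≥0), 1 < lam → lam ≤ 2 → 0 < θmax →
    ∃ C : ℝ, 0 ≤ C ∧
    ∀ (Φ : ℝ → EuclideanSpace ℝ (Fin 3) → ℝ)
      (U : ℝ → EuclideanSpace ℝ (Fin 3) → EuclideanSpace ℝ (Fin 3)) (k R : ℝ),
      0 < R → Measurable (uncurry Φ) → (∀ t x, 0 ≤ Φ t x) →
      AEStronglyMeasurable (uncurry U)
        (volume.restrict (Ioo (-R ^ 2) 0 ×ˢ ball (0 : EuclideanSpace ℝ (Fin 3)) (2 * R))) →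
      (∫⁻ s in Ioo (-R ^ 2) 0, (∫⁻ y in ball (0 : EuclideanSpace ℝ (Fin 3)) (2 * R),
        ‖U s y‖ₑ ^ (3 : ℕ)) ^ (4 / 3 : ℝ) ≤ (N : ℝ≥0∞) * ENNReal.ofReal R ^ 2) →
      NUEnergyClass Φ U k R →
    ∀ (ρ θ t₀ l : ℝ), R / 4 ≤ ρ → lam * ρ ≤ 2 * R → 0 < θ → θ ≤ θmax → t₀ ≤ 0 →
      -R ^ 2 < t₀ - θ * ρ ^ 2 → 0 < l → 2 * l ≤ k →
      ∫⁻ z in (Ioo (t₀ - θ * ρ ^ 2) t₀ ×ˢ ball (0 : EuclideanSpace ℝ (Fin 3)) ρ) ∩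
          {z | Φ z.1 z.2 < l}, ‖fderiv ℝ (Φ z.1) z.2‖ₑ ^ 2 ≤
        ENNReal.ofReal (C * l ^ 2 * ρ ^ 3) := by
  intro lam θmax N hlam hlam2 hθmax
  -- ### absolute constants
  obtain ⟨Cg, hCg0, hCg⟩ := exists_norm_fderiv_radialCutoff_le
  set V₁ : ℝ := (volume (ball (0 : EuclideanSpace ℝ (Fin 3)) 1)).toReal with hV₁
  have hB1fin : volume (ball (0 : EuclideanSpace ℝ (Fin 3)) 1) < ∞ := measure_ball_lt_top
  have hV₁0 : 0 ≤ V₁ := ENNReal.toReal_nonneg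
  set lam' : ℝ := (1 + lam) / 2 with hlam'
  have hlam'1 : 1 < lam' := by rw [hlam']; linarith
  have hlam'2 : lam' < lam := by rw [hlam']; linarith
  have hd0 : 0 < lam' - 1 := by linarith
  set N' : ℝ := (N : ℝ) with hN'
  have hN'0 : 0 ≤ N' := N.coe_nonneg
  set cU : ℝ := (16 * N') ^ (1 / 4 : ℝ) * (16 : ℝ) ^ (1 / 12 : ℝ) *
    (θmax * V₁ * lam' ^ 3) ^ (2 / 3 : ℝ) with hcU
  have hcU0 : 0 ≤ cU := by positivity
  -- the four shape constants
  set T1 : ℝ := V₁ * lam' ^ 3 with hT1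
  set T2 : ℝ := 4 * Cg ^ 2 * θmax * V₁ * lam' ^ 3 / (lam' - 1) ^ 2 with hT2
  set T3 : ℝ := 2 * Cg * cU / (lam' - 1) with hT3
  refine ⟨8 / 3 * (T1 + T2 + T3), by positivity, ?_⟩
  intro Φ U k R hR hΦm hΦ0 hU hdrift hEC ρ θ t₀ l hρR hlamρ hθ hθ2 ht₀ hbot hl hlk
  -- ### geometry
  have hρ : 0 < ρ := by linarith
  set a : ℝ := t₀ - θ * ρ ^ 2 with ha
  have hat : a < t₀ := by
    have : 0 < θ * ρ ^ 2 := by positivity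
    rw [ha]; linarith
  have hta : t₀ - a = θ * ρ ^ 2 := by rw [ha]; ring
  set ρ₁ : ℝ := lam' * ρ with hρ₁def
  have hρρ₁ : ρ < ρ₁ := by
    rw [hρ₁def]; nlinarith
  have hρ₁pos : 0 < ρ₁ := hρ.trans hρρ₁
  have hρ₁R : ρ₁ < 2 * R := by
    rw [hρ₁def]
    calc lam' * ρ < lam * ρ := mul_lt_mul_of_pos_right hlam'2 hρ
      _ ≤ 2 * R := hlamρ
  have hdiff : ρ₁ - ρ = (lam' - 1) * ρ := by rw [hρ₁def]; ring
  have hR4 : R ≤ 4 * ρ := by linarith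
  -- the sub-cylinder `W = [a, t₀[ × B̄(ρ₁)` of the slab
  set W : Set (ℝ × EuclideanSpace ℝ (Fin 3)) :=
    Ico a t₀ ×ˢ closedBall (0 : EuclideanSpace ℝ (Fin 3)) ρ₁ with hW
  have hWsub : W ⊆ Ioo (-R ^ 2) 0 ×ˢ ball (0 : EuclideanSpace ℝ (Fin 3)) (2 * R) :=
    prod_mono (fun s hs => ⟨hbot.trans_le hs.1, hs.2.trans_le ht₀⟩) (closedBall_subset_ball hρ₁R)
  have hWvol : volume W = ENNReal.ofReal (θ * ρ ^ 2) * (ENNReal.ofReal (ρ₁ ^ 3) *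
      volume (ball (0 : EuclideanSpace ℝ (Fin 3)) 1)) := by
    rw [hW, Measure.volume_eq_prod, Measure.prod_prod, Real.volume_Ico, hta,
      Measure.addHaar_closedBall volume _ hρ₁pos.le, finrank_euclideanSpace_fin]
  have hWreal : (volume W).toReal = θ * V₁ * lam' ^ 3 * ρ ^ 5 := by
    rw [hWvol, ENNReal.toReal_mul, ENNReal.toReal_mul, ENNReal.toReal_ofReal (by positivity),
      ENNReal.toReal_ofReal (by positivity), hV₁, hρ₁def]
    ring
  have hVK : (volume (closedBall (0 : EuclideanSpace ℝ (Fin 3)) ρ₁)).toReal = V₁ * lam' ^ 3 * ρ ^ 3 := by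
    rw [Measure.addHaar_closedBall volume _ hρ₁pos.le, finrank_euclideanSpace_fin, ENNReal.toReal_mul,
      ENNReal.toReal_ofReal (by positivity), hV₁, hρ₁def]
    ring
  -- ### the drift integral
  set IU : ℝ≥0∞ := ((N : ℝ≥0∞) * ENNReal.ofReal R ^ 2) ^ (1 / 4 : ℝ) *
    ENNReal.ofReal (R ^ 2) ^ (1 / 12 : ℝ) * volume W ^ (2 / 3 : ℝ) with hIU
  have hIUle : ∫⁻ z in W, ‖U z.1 z.2‖ₑ ≤ IU := lintegral_enorm_drift_le hU hdrift hWsub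
  have hWfin : volume W < ∞ := by
    rw [hWvol]
    exact ENNReal.mul_lt_top ENNReal.ofReal_lt_top (ENNReal.mul_lt_top ENNReal.ofReal_lt_top hB1fin)
  have hIUfin : IU ≠ ∞ := by
    refine ENNReal.mul_ne_top (ENNReal.mul_ne_top ?_ ?_) ?_
    · exact (ENNReal.rpow_lt_top_of_nonneg (by norm_num)
        (ENNReal.mul_ne_top ENNReal.coe_ne_top (ENNReal.pow_ne_top ENNReal.ofReal_ne_top))).ne
    · exact (ENNReal.rpow_lt_top_of_nonneg (by norm_num) ENNReal.ofReal_ne_top).ne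
    · exact (ENNReal.rpow_lt_top_of_nonneg (by norm_num) hWfin.ne).ne
  have hIUreal : IU.toReal = (N' * R ^ 2) ^ (1 / 4 : ℝ) * (R ^ 2) ^ (1 / 12 : ℝ) *
      (θ * V₁ * lam' ^ 3 * ρ ^ 5) ^ (2 / 3 : ℝ) := by
    rw [hIU, ENNReal.toReal_mul, ENNReal.toReal_mul, ← ENNReal.toReal_rpow, ← ENNReal.toReal_rpow,
      ← ENNReal.toReal_rpow, ENNReal.toReal_mul, ENNReal.toReal_pow, ENNReal.toReal_ofReal hR.le,
      ENNReal.toReal_ofReal (by positivity), hWreal, ENNReal.coe_toReal]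
  have hIUbound : IU.toReal ≤ cU * ρ ^ 4 := by
    rw [hIUreal, hcU]
    exact drift_real_bound hN'0 hR hρ hR4 hθ hθ2 hV₁0 (by linarith)
  -- ### the energy bound and the constant bookkeeping
  have hmain := nu_lintegral_fderiv_sq_sublevel_le_of_energyClass' Φ U k R hΦm hΦ0 hU hEC hρ hρρ₁
    hρ₁R hbot hat ht₀ hl hlk hCg0 (hCg ρ ρ₁ hρ.le hρρ₁) hIUfin hIUle
  refine hmain.trans (ENNReal.ofReal_le_ofReal ?_)
  rw [hVK, hta, hdiff]
  -- the landed four-term bookkeeping with axis constant `C₁ = 0`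
  have h := shape_real_algebra (l := l) (C₁ := 0) (Iρ' := θ * ρ ^ 2 * (0 * (4 * lam' ^ 2 * ρ ^ 2)))
    hCg0 le_rfl hV₁0 hlam'1 hθ hθ2 hρ hIUbound rfl
  have e1 : 4 * (Cg / ((lam' - 1) * ρ)) * (θ * ρ ^ 2 * (0 * (4 * lam' ^ 2 * ρ ^ 2))) = 0 := by ring
  have e2 : 16 * Cg * (0 : ℝ) * θmax * lam' ^ 2 / (lam' - 1) = 0 := by ring
  rw [e1, e2, add_zero, add_zero] at h
  exact h

/-- **Nazarov–Uraltseva 2012, Lemma 3.3 (shrinking levels), AXIS-FREE standing hypotheses — the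
text `Sig.nu_shrinking` of the N4 skeleton** (constants `(λ_lo, θ_lo, θ_hi, μ, δ₁, N) ↦ s`; the outer
ratio `lam ∈ [λ_lo, 2]` is free, the cut-off being taken at ratio `(1+λ_lo)/2`).
[cite: NazarovUraltseva2011HarnackDivFree, §3 Lemma 3.3; NazarovUraltseva2012, Lemma 3.3, Remarks 5, 9] -/
theorem nu_shrinking :
    ∀ (lamlo θlo θhi μ δ₁ : ℝ) (N : ℝ≥0), 1 < lamlo → lamlo ≤ 2 → 0 < θlo → θlo ≤ θhi →
      0 < μ → μ < 1 → 0 < δ₁ →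
    ∃ s : ℕ,
    ∀ (Φ : ℝ → EuclideanSpace ℝ (Fin 3) → ℝ) (U : ℝ → EuclideanSpace ℝ (Fin 3) → EuclideanSpace ℝ (Fin 3)) (k R : ℝ),
      NUStanding Φ U k R N →
    ∀ (lam ρ θ t₀ κ₀ : ℝ), lamlo ≤ lam → lam ≤ 2 → R / 4 ≤ ρ → lam * ρ ≤ 2 * R → θlo ≤ θ → θ ≤ θhi →
      t₀ ≤ 0 → -R ^ 2 < t₀ - θ * ρ ^ 2 → 0 < κ₀ → κ₀ ≤ k →
      (∀ᵐ t ∂(volume.restrict (Ioo (t₀ - θ * ρ ^ 2) t₀)),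
        ENNReal.ofReal δ₁ * volume (ball (0 : EuclideanSpace ℝ (Fin 3)) ρ)
          ≤ volume {x : EuclideanSpace ℝ (Fin 3) | x ∈ ball (0 : EuclideanSpace ℝ (Fin 3)) ρ ∧ κ₀ ≤ Φ t x}) →
      volume {z : ℝ × EuclideanSpace ℝ (Fin 3) | z ∈ Ioo (t₀ - θ * ρ ^ 2) t₀ ×ˢ ball (0 : EuclideanSpace ℝ (Fin 3)) ρ ∧
          Φ z.1 z.2 < (2 : ℝ)⁻¹ ^ s * κ₀}
        ≤ ENNReal.ofReal μ * volume (Ioo (t₀ - θ * ρ ^ 2) t₀ ×ˢ ball (0 : EuclideanSpace ℝ (Fin 3)) ρ) := by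
  intro lamlo θmin θmax μ δ₁ N hlam hlam2 hθmin hθmm hμ hμ1 hδ₁
  have hθmax : 0 < θmax := hθmin.trans_le hθmm
  obtain ⟨C, hC0, hC⟩ := nu_lintegral_fderiv_sq_sublevel_le_shape' lamlo θmax N hlam hlam2 hθmax
  set V₁ : ℝ := (volume (ball (0 : EuclideanSpace ℝ (Fin 3)) 1)).toReal with hV₁
  have hV₁pos : 0 < V₁ :=
    ENNReal.toReal_pos (measure_ball_pos _ _ one_pos).ne' measure_ball_lt_top.ne
  set K₀ : ℝ := 4 * (64 * Real.pi / 3) ^ 2 * C / (δ₁ ^ 2 * μ ^ 2 * θmin * V₁ ^ 3) with hK₀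
  set s₀ : ℕ := ⌈K₀⌉₊ + 1 with hs₀
  refine ⟨s₀ + 1, ?_⟩
  intro Φ U k R hSt lam ρ θ t₀ κ₀ hlamlo hlam2' hρR hlamρ' hθ1 hθ2 ht₀ hbot hκ₀ hκ₀k hdens
  obtain ⟨-, hR, hΦm, hUvol, -, hΦ0, hC1, hdrift, hEC⟩ := hSt
  have hU : AEStronglyMeasurable (uncurry U)
      (volume.restrict (Ioo (-R ^ 2) 0 ×ˢ ball (0 : EuclideanSpace ℝ (Fin 3)) (2 * R))) :=
    hUvol.restrict
  have hlamρ : lamlo * ρ ≤ 2 * R := by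
    have hρ0 : 0 < ρ := by linarith
    nlinarith
  have hρ : 0 < ρ := by linarith
  have hθ : 0 < θ := hθmin.trans_le hθ1
  set a : ℝ := t₀ - θ * ρ ^ 2 with ha
  have hat : a < t₀ := by
    have : 0 < θ * ρ ^ 2 := by positivity
    rw [ha]; linarith
  -- ### the hypotheses of the measure-theoretic core
  have hΦm' : AEStronglyMeasurable (uncurry Φ)
      (volume.restrict (Ioo a t₀ ×ˢ ball (0 : EuclideanSpace ℝ (Fin 3)) ρ)) :=
    hΦm.aestronglyMeasurable
  have hgood : ∀ᵐ t ∂(volume.restrict (Ioo a t₀)), ContDiff ℝ 1 (Φ t) := by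
    filter_upwards [ae_restrict_mem measurableSet_Ioo, ae_restrict_of_ae hC1] with t ht h
    exact h ⟨hbot.trans ht.1, ht.2.trans_le ht₀⟩
  have hDm : AEStronglyMeasurable
      (fun z : ℝ × EuclideanSpace ℝ (Fin 3) => fderiv ℝ (Φ z.1) z.2)
      (volume.restrict (Ioo a t₀ ×ˢ ball (0 : EuclideanSpace ℝ (Fin 3)) ρ)) :=
    aestronglyMeasurable_fderiv_slice_restrict_prod hΦm
      (hgood.mono fun t ht => ht.differentiable one_ne_zero)
  have hC1' : ∀ᵐ t ∂(volume.restrict (Ioo a t₀)),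
      ContDiffOn ℝ 1 (Φ t) (ball (0 : EuclideanSpace ℝ (Fin 3)) ρ ∩ {x | cylRadius x ≠ 0}) :=
    hgood.mono fun t ht => ht.contDiffOn
  have hδ' : ∀ᵐ t ∂(volume.restrict (Ioo a t₀)),
      ENNReal.ofReal δ₁ * volume (ball (0 : EuclideanSpace ℝ (Fin 3)) ρ) ≤
        volume (ball (0 : EuclideanSpace ℝ (Fin 3)) ρ ∩ {x | κ₀ ≤ Φ t x}) := by
    filter_upwards [hdens] with t ht
    simpa only [inter_def, mem_setOf_eq] using ht
  have hE' : ∀ m : ℕ, 1 ≤ m →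
      ∫⁻ z in (Ioo a t₀ ×ˢ ball (0 : EuclideanSpace ℝ (Fin 3)) ρ) ∩ {z | Φ z.1 z.2 < κ₀ / 2 ^ m},
        ‖fderiv ℝ (Φ z.1) z.2‖ₑ ^ 2 ≤ ENNReal.ofReal (C * (κ₀ / 2 ^ m) ^ 2 * ρ ^ 3) := by
    intro m hm
    have hl : 0 < κ₀ / 2 ^ m := by positivity
    have h2m : (2 : ℝ) ≤ 2 ^ m := by
      calc (2 : ℝ) = 2 ^ 1 := by norm_num
        _ ≤ 2 ^ m := pow_le_pow_right₀ (by norm_num) hm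
    have h2l : 2 * (κ₀ / 2 ^ m) ≤ k := by
      have h1 : 2 * (κ₀ / 2 ^ m) ≤ κ₀ := by
        rw [mul_div_assoc', div_le_iff₀ (by positivity)]
        nlinarith
      linarith
    exact hC Φ U k R hR hΦm hΦ0 hU hdrift hEC ρ θ t₀ (κ₀ / 2 ^ m) hρR hlamρ hθ hθ2 ht₀ hbot hl h2l
  -- ### the choice of `s`
  have hs₀pos : 0 < s₀ := Nat.succ_pos _
  have hsK : 4 * (64 * Real.pi / 3) ^ 2 * C * ρ ^ 2 /
      (δ₁ ^ 2 * μ ^ 2 * (t₀ - a) * (volume (ball (0 : EuclideanSpace ℝ (Fin 3)) 1)).toReal ^ 3)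
        ≤ s₀ := by
    have hta : t₀ - a = θ * ρ ^ 2 := by rw [ha]; ring
    rw [hta, ← hV₁]
    have hnum : 0 ≤ 4 * (64 * Real.pi / 3) ^ 2 * C := by positivity
    calc 4 * (64 * Real.pi / 3) ^ 2 * C * ρ ^ 2 / (δ₁ ^ 2 * μ ^ 2 * (θ * ρ ^ 2) * V₁ ^ 3)
        = 4 * (64 * Real.pi / 3) ^ 2 * C / (δ₁ ^ 2 * μ ^ 2 * θ * V₁ ^ 3) := by
          field_simp
      _ ≤ K₀ := by
          rw [hK₀]
          exact div_le_div_of_nonneg_left hnum (by positivity) (by gcongr)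
      _ ≤ (⌈K₀⌉₊ : ℝ) := Nat.le_ceil _
      _ ≤ (s₀ : ℝ) := by rw [hs₀]; push_cast; linarith
  have hcore := shrinkingLevels_measure_le Φ 0 ρ a t₀ κ₀ δ₁ C hρ hat hκ₀ hδ₁ hC0 hΦm' hDm hC1'
    hδ' hE' hμ hs₀pos hsK
  -- ### the level `2^{-(s₀+1)} κ₀` and the set
  have hlev : (2 : ℝ)⁻¹ ^ (s₀ + 1) * κ₀ = κ₀ / 2 ^ (s₀ + 1) := by
    rw [inv_pow]; field_simp
  simp_rw [hlev]
  simpa only [inter_def, mem_setOf_eq] using hcore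


end Summit.NavierStokesRegularity.NavierStokesRegularity.Theorems.AveragedConeLiouville.NU

end
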